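import Mathlib
import HarnessLib
import HarnessLib.Audit
import Summits.QuantumAdvantage.Statement
import Literature.Computability.Complexity.CircuitClasses
import Literature.Computability.QuantumComplexity.StabilizerRank
import Literature.Computability.Cryptography.TCount
import HarnessLib.Audit.Status.Attr

/-!
Route: Dequantize

DORMANT since 2026-08-23T04:26:23Z (reconciler: no traction for 5.9 d (last activity statement-grounded at 2026-08-17T06:24:47Z); parked, not closed — `ledger route dormant route-QuantumAdvantage-Dequantize --off` to reactivate) — unstaffed, not closed; items shared with open routes are served there. `ledger route dormant <id> --off` reactivates.

# Route QuantumAdvantage/Dequantize — the NEGATION side: BQP ⊆ BPP via P-uniform polynomial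
stabilizer rank of the magic state

## Thesis X (decides `QuantumAdvantage` NEGATIVELY: quantum-advantage.S02, `BQP = BPP`)
It suffices to show X = `DeqThesis`: every language decided with error ≤ 1/3 by a poly-time-uniform,
oracle-free
Clifford+T circuit family is in BPP. X is reached from the route's bet, crux
`DeqStabrankPolyUniform` (hypothesis (a):
a poly(t,k)-time scheme writing the magic state |T⟩^{⊗t} within squared distance 1/(k+1)² as a
Gaussian-rational
combination of polynomially many Clifford states = P-uniform polynomial δ-approximate stabilizer
rank at every precision),
through the in-print simulation theorem `DeqStabrankPolyImpliesCollapse` ((a) → X: magic-state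
gadgetisation + stabilizer
norm estimation, BravyiGosset2016 §2–4, BravyiEtAl2019 §2.3.1). The kill crux
`DeqNegStabrankSuperpoly` (superpolynomial
χ_δ(|T⟩^{⊗t}) for some δ < 1) is the S-side object this route exists to offer.
Lean: `Literature.Computability.Cryptography.BQP ⊆ Literature.Computability.Complexity.BPP`

## Assembly (X → ¬Statement)
Pure logic: the summit is the existential `∃ L, L ∈ BQP ∧ L ∉ BPP`, so X refutes it directly —
`Assembly := DeqThesis → ¬ QuantumAdvantage`
(no `BPP ⊆ BQP` hypothesis is needed; rev ≤ 3 carried the named fact `BPP_subset_BQP` as a vacuous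
extra hypothesis, removed in rev 4).
Deciding theorem (D-0027 §2.1): `closes : DeqStabrankPolyUniform → DeqStabrankPolyImpliesCollapse →
¬ QuantumAdvantage`.

Rationale: WHY THIS LINE. `Literature.Computability.Cryptography.BQP` is literally poly-time-uniform
Clifford+T, and Clifford+T has a canonical classical
simulation theory: T-free (Clifford) families are simulable exactly in polynomial time
(Gottesman1998 Thm 1; AaronsonGottesman2004 §III), and t T-gates
cost 2^{βt}·poly(n) through stabilizer decompositions of the magic state — β = log₂7/6 ≈ 0.468 from
χ(|H⟩^{⊗6}) ≤ 7 (BravyiSmithSmolin2016 =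
arXiv:1506.01396 p.5; BravyiGosset2016), β = log₂3/4 ≈ 0.396 the best in print (arXiv:2605.28586
p.4); the exponent is governed by the approximate
stabilizer rank χ_δ(|T⟩^{⊗t}) (BravyiEtAl2019 §2.1 Def 2, §2.3.1; tree
`Literature.Computability.QuantumComplexity.approxStabilizerRank`). X follows if
χ_δ grows polynomially in (t, 1/δ) WITH P-uniform decompositions — hypothesis (a), which print calls
a complexity-theoretic heresy (BravyiEtAl2019 p.6;
PelegShpilkaVolk2022 p.4) but cannot exclude: unconditional lower bounds are Ω(t) exact
(PelegShpilkaVolk2022 Thm 1.1; Labib2022 Thm 1.1) and Ω̃(t²)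
approximate (MehrabanTahmasbi2024 Thm 1.1); BravyiSmithSmolin2016 p.7 only conjecture χ ≥ 2^{Ω(t)}.
Imported field: additive combinatorics /
higher-order Fourier analysis (stabilizer states are quadratic phase functions on 𝔽₂ⁿ; rank lower
bounds run through U³-type structure) — that is where
the kill crux lives. The line is non-black-box (it consumes the explicit gate list), hence outside
the relativization / algebrization classes that
forbid proofs of BQP ⊆ BPP; it exists so the S-side has a concrete refutable object and so the
T-count ladder (T-count 0 and O(log n) decide only P
languages) is formalised against our circuit model.

RANKED CRUXES. #2 DeqStabrankPolyUniform (stmt-1036) — hypothesis (a), uniform form: a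
poly(t,k)-time computable D(t,k) listing (T-free oracle-free
Clifford circuit C_j on t qubits, Gaussian-rational c_j) with ‖|T⟩^{⊗t} − Σ_j c_j C_j|0^t⟩‖² ≤
1/(k+1)² (why it might fail: likely FALSE — poly χ_δ is
"heresy" (BravyiEtAl2019 p.6), ETH-type hypotheses force 2^{Ω(t)} (PelegShpilkaVolk2022 p.4), perm ∉
P/poly ⇒ superpolynomial exact rank
(MehrabanTahmasbi2024 Thm 1.6), and with 0244 it puts FACTORING in BPP; sources: BravyiEtAl2019,
PelegShpilkaVolk2022, MehrabanTahmasbi2024,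
BravyiGosset2016). #5 DeqNegStabrankSuperpoly (stmt-0247) — the declared KILL, S-side: ∃ δ ∈ (0,1)
with χ_δ(|T⟩^{⊗t}) eventually above every t^c + c
(why it might fail: may itself be false and is beyond present technique — methods stall at Ω̃(t²):
PelegShpilkaVolk2022 §1.5, MehrabanTahmasbi2024
p.8; sources: idem, Labib2022, arXiv:2503.04101, arXiv:2605.28586). SUPPORT (theorems in print,
formalisation-heavy, not staffing keys):
DeqStabrankPolyImpliesCollapse (stmt-0244; rev 4 restated BY NAME as `DeqStabrankPolyUniform →
DeqThesis`, dropping the `encodeRat` spelling and with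
it the EuclideanLattices import: the Bravyi–Gosset simulation theorem given (a) — BravyiGosset2016
§2–4, BravyiEtAl2019 §2.3.1, PelegShpilkaVolk2022 p.4
"up to uniformity issues having to do with finding the decomposition" = the PolyTimeComputable
clause of #2); DeqStabrankPolyImpliesBQPSubsetPPoly
(stmt-0470; non-uniform printed form, MehrabanTahmasbi2024 Thm 1.10 + Adleman ⇒ BQP ⊆ P/poly);
DeqGottesmanKnillUniform (stmt-0245; T-count 0 ⇒ L ∈
P); DeqLogTcountInPV2 (stmt-0471; T-count ≤ c·log₂ n + c ⇒ L ∈ P; the duplicate DeqTcountLog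
stmt-0246 with the inline countP counter is dropped in
rev 4). TARGET #0 DeqThesis (X); ASSEMBLY #1 `DeqThesis → ¬ QuantumAdvantage`.

KILL CRITERIA. DeqNegStabrankSuperpoly proved for some δ < 1 refutes DeqStabrankPolyUniform (a
refuter then files `¬ DeqStabrankPolyUniform` by name;
the k ↔ δ and normalisation bookkeeping is routine) → route BROKEN → pivot to another dequantisation
resource (Pauli-path / Fourier sparsity,
tensor-network width) with new cruxes implying DeqThesis and a new `closes`, or `route close
--reason refuted:DeqStabrankPolyUniform`. A proof of
QuantumAdvantage anywhere moots the route (it is the negation side). Conjectural hypotheses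
(`FACTORING ∉ BPP`, PH infinite) are NOT kills.

NOT DECOMPOSED YET. The proof of 0244 — magic-state gadgetisation inside `QCircuit` with classically
controlled S corrections, the acceptance
probability of the gadgetised circuit as a χ²-term sum of phase-sensitive stabilizer inner products
(AaronsonGottesman2004 §III; BravyiGosset2016 §3,
O(n³) each), the norm-estimation / sampling estimator to additive error 1/10 with Chernoff
bookkeeping, and packaging the sampler as a `bp P` machine —
is the foreseen glued split 0244 ⇐ (gadgetised acceptance probability = stabilizer sum) → (poly-time
randomized estimator) → 0244, filed only once #2
moves; exact stabilizer inner products are provable-now lemmas that ride with `--supports`. No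
definition requests outstanding (approxStabilizerRank,
tensorPow, magicT, QCircuit.tCount have landed).

CHEAPEST FALSIFIER. For the bet (#2): any explicit candidate scheme D(t,k) must already match the
small-t table χ(|H⟩^{⊗t}) ≤ 2, 2, 3, 4, 6, 7 for t =
1…6 (BravyiSmithSmolin2016 p.5, believed tight) and MehrabanTahmasbi2024 Thm 1.1 (χ_δ(|T⟩^{⊗t}) ≥
c·t²/polylog t for every fixed δ < 1) — a refuter
checks a proposed D numerically at t ≤ 6 and against the quadratic bound before anything else. For
the line as a whole the cheapest kill is a
literature lookup: a printed superpolynomial lower bound on χ_δ(|T⟩^{⊗t}) for one fixed δ < 1 (none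
exists as of arXiv:2605.28586, 2026: exact Ω(t),
approximate Ω̃(t²)).

SOURCES. Gottesman1998; AaronsonGottesman2004; BravyiSmithSmolin2016 (arXiv:1506.01396);
BravyiGosset2016 (arXiv:1601.07601); BravyiEtAl2019
(arXiv:1808.00128); PelegShpilkaVolk2022 (arXiv:2106.03214); Labib2022 (arXiv:2107.10551);
MehrabanTahmasbi2024 (arXiv:2305.10277); arXiv:2503.04101
(Kalra–Sinha 2025); arXiv:2605.28586 (Labib–Russo 2026); BernsteinVazirani1997 §8.

Novelty: Nearest prior art (searched 2026-08-14: `lit search "stabilizer rank lower bound" --source all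
--year-from 2022` (local hits arXiv:2106.03214, 2305.10277, 2503.04101, 2110.07781, 2107.10551,
2605.28586, 2209.14530, 2304.10570), `lit search --hybrid "approximate stabilizer rank magic state
lower bound superpolynomial"` (no book treats it), `lit frontier QuantumAdvantage --since 2020`,
`lit bridges QuantumAdvantage --cross any`, `lit read` of arXiv:1808.00128 p.6, arXiv:2106.03214
pp.3–6, arXiv:2305.10277 pp.1–9, arXiv:2503.04101 pp.1–3, arXiv:2605.28586 p.4): the thesis
mechanism — polynomial (approximate) stabilizer rank of |T⟩^{⊗t} with efficiently findable
decompositions ⇒ BQP ⊆ BPP through Bravyi–Gosset magic-state gadgetisation — is stated in print: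
BravyiEtAl2019 (arXiv:1808.00128) p.6 "the polynomial scaling of χ_δ(T^{⊗m}) or χ(T^{⊗m}) would
entail complexity theoretic heresies such as BQP=BPP or P=NP"; PelegShpilkaVolk2022
(arXiv:2106.03214) p.4 "an upper bound which is polynomial (in n) on χ … will imply that BPP = BQP …
This implication holds up to uniformity issues having to do with finding the decomposition of
|T⟩^{⊗n}"; MehrabanTahmasbi2024 (arXiv:2305.10277) p.6 Thm 1.10 (poly χ_δ ⇒ BPP/poly sampler within
O(δ) TV — literally item DeqStabrankPolyImpliesBQPSubsetPPoly) and p.5–7 Thm 1.6 / Cor 1.9 / Thm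
1.11 (superpolynomial rank CONDITIONALLY on perm ∉ P/poly resp. #P-hardness of approximate
amplitudes + PH infinite — conditional forms of the kill item DeqNegStabr  [refs: 2106.03214, 1808.00128, 2305.10277, 2503.04101, 2605.28586, 1601.07601, 2110.07781, BravyiEtAl2019, PelegShpilkaVolk2022, MehrabanTahmasbi2024, BravyiGosset2016, Gottesman1998, AaronsonGottesman2004, Labib2022, BravyiSmithSmolin2016]

Barriers (technique_class: simulation, stabilizer-rank, dequantization, non-black-box): Two catalogued entries name this route's thesis `DeqThesis : BQP ⊆ BPP` explicitly, both as
constraints on PROOF TECHNIQUE, and the line falls outside both technique classes.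
Literature.Barriers.QuantumAdvantage.Relativization (proved reading
`Relativization.not_relativizes_collapse_shape`: no relativizing proof of `O ↦ BQP^O ⊆ BPP^O` at O =
∅, since BQP^O ⊄ BPP^O for the Bernstein–Vazirani/Simon oracles, tree fact
exists_oracle_BQPRel_not_subset_BPPRel, BernsteinVazirani1997SICOMP Thm 8.10/Cor 8.14) — EVADED in
kind: a stabilizer-rank simulation is non-black-box; it consumes the explicit Clifford+T gate list
gate by gate (tableau updates for H, S, CNOT; magic-state gadgets for T) and has no counterpart for
an oracle gate, which maps a superposition of poly many stabilizer states outside any such span;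
hypothesis (a) implies nothing about BQP^O and the argument does not relativize (the same reason
Gottesman–Knill coexists with BQP^O ⊄ BPP^O). Literature.Barriers.QuantumAdvantage.Algebrization
(`Algebrization.not_isAlgebrizingInclusion_bqp_bpp`, AaronsonWigderson2008 Thm 5.11(v): "proving BPP
= BQP will require non-algebrizing techniques") — same verdict: the simulation is not an inclusion
argument of the form C^A ⊆ D^Ã and is not arithmetization; it uses the gate set, not oracle access.
Literature.Barriers.QuantumAdvantage.PPolyOracles (AaronsonChen2017 Thm 8.1: an unconditional
quantum/classical SEPARATION relative to an efficiently computable oracle already proves SampBPP ≠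

Novelty grade: known — route-review refuter 2026-08-15 (novelty graded on the route's OWN cited pages, re-read from held texts this session: BBCCGH19 p.6 L60-65 verbatim 'the polynomial scaling of χ_δ(T^{⊗m}) or χ(T^{⊗m}) would entail complexity theoretic heresies such as BQP=BPP or P=NP … we have no techniques for provin (refuter refuter-rreview1-QuantumAdvantage-Dequantize-5a6faeb9-0, 2026-08-15T18:27:19Z; prior: arXiv:1808.00128 p.6 (BBCCGH19: poly χ_δ(T^⊗m) 'would entail … BQP=BPP'), arXiv:2106.03214 p.4 (PSV22: poly χ ⇒ BPP=BQP 'up to uniformity issues having to do with finding the decomposition'), arXiv:2305.10277 Thm 1.10 (MT24: poly χ_δ ⇒ BPP/poly sampler), arXiv:1601.07601 §4 (BG16 random-sample gadget simulation), arXiv:2605.28586 p.4 (2026 frontier: exact Ω(m), approximate Ω̃(m²)))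

History (route lifecycle, newest last):
- 2026-08-15T16:13:50Z · rev 4: restated DeqStabrankPolyImpliesCollapse (stmt-QuantumAdvantage-0244), Assembly (stmt-QuantumAdvantage-0243) — route-repair rev 4 (glue + cone + schema): deciding theorem `closes (hU : DeqStabrankPolyUniform) (hC : DeqStabrankPolyImpliesCollapse) : ¬ _root_.QuantumAdvant (planner-rbadge-QuantumAdvantage-Dequantize-5a6faeb9-g2-0)
- 2026-08-15T16:13:50Z · rev 4: dropped DeqTcountLog — route-repair rev 4 (glue + cone + schema): deciding theorem `closes (hU : DeqStabrankPolyUniform) (hC : DeqStabrankPolyImpliesCollapse) : ¬ _root_.QuantumAdvant (planner-rbadge-QuantumAdvantage-Dequantize-5a6faeb9-g2-0)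
- 2026-08-23T04:26:23Z · DORMANT — reconciler: no traction for 5.9 d (last activity statement-grounded at 2026-08-17T06:24:47Z); parked, not closed — `ledger route dormant route-QuantumAdvantage- (operator:999:1359395)

sub-problem: QuantumAdvantage · status: dormant · opened planner-QuantumAdvantage-Survey-0 2026-08-13T06:04:27Z · rev 4 · ledger route-QuantumAdvantage-Dequantize
GENERATED by the gate from the ledger (D-0016/17). Provers cite these decls: `theorem foo : Summit.QuantumAdvantage.QuantumAdvantage.Theses.Dequantize.<Decl> := …` in Summits/QuantumAdvantage/QuantumAdvantage/Theorems/<Name>.lean.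
-/

namespace Summit.QuantumAdvantage.QuantumAdvantage.Theses.Dequantize

open scoped BigOperators Topology Manifold Classical MeasureTheory ProbabilityTheory Matrix InnerProductSpace ComplexConjugate ContinuousMap
open Filter Set Function TopologicalSpace MeasureTheory

attribute [summit_statement] _root_.QuantumAdvantage

open Literature.QuantumAdvantage

/-- item stmt-QuantumAdvantage-0242 · target · rank 0 · open · by planner
why it might fail: X = BQP ⊆ BPP puts FACTORING in BPP (Shor; tree Cryptography/Shor.lean FACT_mem_BQP) and runs against the oracle evidence BQP^O ⊄ BPP^O, ⊄ PH^O (BV97 Thm 8.10/Cor 8.14, Raz–Tal); every dequantisation in print is exponential in some resource (BG16: 2^{βt}, β ≤ 1/2), none reaches uniform BQP.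
sources: BernsteinVazirani1997SICOMP Thm 8.10, Cor 8.14 (recursive Fourier sampling oracle), Shor1997 §5 (tree def Literature.Computability.Cryptography.FACT_mem_BQP, Literature/Computability/Cryptography/Shor.lean:94), RazTalJACM2022 Thm 1.1 (tree exists_oracle_BQPRel_not_subset_PHRel_of, OracleSeparationBQPPH.lean:1299), tree def H21 exists_oracle_BQPRel_not_subset_BPPRel (Literature/Computability/QuantumComplexity/OracleSeparations.lean:79), BravyiGosset2016 = arXiv:1601.07601 p.2 eq.(2) (runtime 2^{βt} t³ ε⁻², β ≤ 1/2: bounded-T subclasses only); tree fact BravyiGosset2016_estimateAcceptProb (StabilizerSimulation.lean:239), NielsenChuang2010 §4.5.5 p.262 (BPP ⊆ BQP ⊆ PSPACE; status open)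
Thesis X of route Dequantize, targeting ¬QuantumAdvantage (quantum-advantage.S02, BQP = BPP): every
uniform Clifford+T family with error 1/3 is simulable in BPP. [BernsteinVazirani1997 §8;
BravyiGosset2016] -/
@[route_item "route-QuantumAdvantage-Dequantize"]
def DeqThesis : Prop :=
  Literature.Computability.Cryptography.BQP ⊆ Literature.Computability.Complexity.BPP

/-- item stmt-QuantumAdvantage-1036 · crux · rank 2 · open · by planner
why it might fail: Likely FALSE: print calls poly χ_δ(T^{⊗t}) a heresy (BBCCGH19 p.6); ETH-type hypotheses force χ = 2^{Ω(t)} (PSV22 p.4: MT19, HNS20); perm ∉ P/poly ⇒ superpoly exact rank (MT24 Thm 1.6); with 0244 it puts FACTORING in BPP. Open: only Ω̃(t²) proved (MT24 Thm 1.1).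
sources: BravyiEtAl2019 = arXiv:1808.00128 p.6 ('polynomial scaling of χ_δ(T^{⊗m}) … would entail … BQP=BPP or P=NP'), §2.1 Def 2 (χ_δ), §2.3.1, PelegShpilkaVolk2022 = arXiv:2106.03214 p.4 (poly χ ⇒ BPP=BQP 'up to uniformity issues having to do with finding the decomposition'; ETH-type ⇒ 2^{Ω(n)}), Thm 1.1-1.2, p.6 §1.5, MehrabanTahmasbi2024 = arXiv:2305.10277 Thm 1.1 (χ_δ(T^{⊗m}) = Ω̃(m²)), Thm 1.6 (superpoly exact rank unless perm ∈ P/poly), Thm 1.10 (poly χ_δ ⇒ BPP/poly sampler), BravyiGosset2016 = arXiv:1601.07601 §2-4 (magic-state gadgetisation; χ(T^{⊗6}) ≤ 7, exponent ≈ 0.47), arXiv:2605.28586 p.4 (2026 status: exact Ω(t), approximate Ω̃(t²); qubit upper exponent log₂3/4 ≈ 0.396), tree: Literature/Computability/QuantumComplexity/StabilizerRank.lean:104 (approxStabilizerRank; tensorPow, magicT); StabilizerSimulation.lean:137 (BravyiEtAl2019_approxStabilizerRank_magicT_pow)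
[crux] HYPOTHESIS (a), UNIFORM form — the route's actual bet, filed as the rank-2 crux that both
retriage passes (gen-1/gen-2, 2026-08-14) recommended, giving the (a)/¬(a) pair with
DeqNegStabrankSuperpoly (0247): there is a decomposition scheme D(t,k), computable in time poly(t,k)
from unary (t,k), listing pairs (oracle-free, T-free i.e. Clifford circuit C_j on t qubits;
Gaussian-rational coefficient c_j) with ‖ |T⟩^{⊗t} − Σ_j c_j · C_j|0^t⟩ ‖² ≤ 1/(k+1)² — polynomial,
P-uniform δ-approximate stabilizer rank of the magic state |T⟩^{⊗t} at every precision δ = 1/(k+1).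
It is VERBATIM the antecedent of DeqStabrankPolyImpliesCollapse (0244) with `encodeRat q` unfolded
to `boolPair (encodingIntBool.encode q.num) (encodeNat q.den)` (definitionally equal, `rfl`; so this
decl needs no EuclideanLattices import): modus ponens with 0244 yields DeqThesis (BQP ⊆ BPP); taking
k = ⌈1/δ⌉ yields the non-uniform hypothesis of DeqStabrankPolyImpliesBQPSubsetPPoly (0470) (⇒ BQP ⊆
P/poly, lethal for route CircuitLB). Killed by 0247 for any δ < 1. Status: OPEN; print calls a
polynomial bound a complexity-theoretic heresy; known bounds χ_δ(T^{⊗t}) ≤ O(δ⁻² 2^{0.396 t}) above,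
Ω̃(t²) below. Why it might f -/
@[route_item "route-QuantumAdvantage-Dequantize", crux]
def DeqStabrankPolyUniform : Prop :=
  ∃ D : (t : ℕ) → ℕ → List (Literature.Computability.Cryptography.QCircuit Literature.Computability.Cryptography.cliffordT t × ℚ × ℚ), Literature.Computability.Complexity.PolyTimeComputable (fun p : ℕ × ℕ => Literature.Computability.Complexity.boolPair (Computability.unaryEncodeNat p.1) (Computability.unaryEncodeNat p.2)) (fun o : (Σ t : ℕ, List (Literature.Computability.Cryptography.QCircuit Literature.Computability.Cryptography.cliffordT t × ℚ × ℚ)) => Literature.Computability.Complexity.boolPair (Computability.encodeNat o.1) ((o.2.map fun x => Literature.Computability.Complexity.boolPair x.1.encode (Literature.Computability.Complexity.boolPair (Literature.Computability.Complexity.boolPair (Literature.Computability.Complexity.encodingIntBool.encode x.2.1.num) (Computability.encodeNat x.2.1.den)) (Literature.Computability.Complexity.boolPair (Literature.Computability.Complexity.encodingIntBool.encode x.2.2.num) (Computability.encodeNat x.2.2.den)))).foldr Literature.Computability.Complexity.boolPair [])) (fun p => ⟨p.1, D p.1 p.2⟩) ∧ (∀ t k, ∀ x ∈ D t k, x.1.IsOracleFree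 ∧ x.1.tCount = 0) ∧ ∀ t k, Literature.Computability.Cryptography.normSq (Literature.Computability.QuantumComplexity.tensorPow Literature.Computability.QuantumComplexity.magicT t - ((D t k).map fun x => ((x.2.1 : ℂ) + (x.2.2 : ℂ) * Complex.I) • Matrix.mulVec (x.1.toMatrix 0) (Literature.Computability.Cryptography.zeroState t)).sum) ≤ (1 / ((k : ℝ) + 1)) ^ 2

/-- item stmt-QuantumAdvantage-0247 · crux · rank 5 · open · by planner
why it might fail: May be FALSE (poly χ_δ(T^{⊗t}) for all δ<1 not excluded; upper 2^{0.396t}) and beyond reach: unconditionally only Ω(t) exact / Ω̃(t²) approximate known (PSV22 Thm 1.1–1.2; MT24 Thm 1.1; still so in arXiv:2605.28586 p.4); PSV22 p.6: methods stall at linear; superpoly only conditional (MT24 Thm 1.6).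
sources: MehrabanTahmasbi2024 = arXiv:2305.10277 p.3 Thm 1.1 (χ_δ(T^{⊗m}) = Ω(m²)/polylog, 0<δ<1), p.5 Thm 1.6 (superpoly exact rank unless perm ∈ P/poly), p.8 ('super-quadratic … much more challenging'), BravyiEtAl2019 = arXiv:1808.00128 p.6 ('we have no techniques for proving unconditional super-polynomial lower bounds'; χ_δ(T^{⊗m}) ≤ O(δ⁻² cos(π/8)^{-2m})), PelegShpilkaVolk2022 = arXiv:2106.03214 p.4 Thm 1.1 (χ = Ω(n) exact), Thm 1.2 (χ_δ = Ω(√n/log n)), p.6 §1.5 ('seem incapable of proving super-linear lower bounds'); p.4: ETH-type hypotheses give 2^{Ω(n)} [MT19, HNS20], Labib2022 = arXiv:2107.10551 Thm 1.1 (Ω(n) exact, prime qudits); arXiv:2110.07781 (Lovitz–Steffan, alternative Ω(n)), arXiv:2503.04101 (Kalra–Sinha 2025) Cor 3 (Ω(n/log n) at exponentially small fidelity); arXiv:2605.28586 (Labib–Russo 2026) p.4 (status: exact Ω(m), approximate Ω̃(m²); qubit upper exponent log₂3/4 ≈ 0.396), tree def Literature.Computability.QuantumComplexity.approxStabilizerRank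 (Literature/Computability/QuantumComplexity/StabilizerRank.lean:104, unnormalised φ: item ≥ print conjecture up to δ ↦ 2δ); tree fact BravyiEtAl2019_approxStabilizerRank_magicT_pow (StabilizerSimulation.lean:137)
NEGATION of the hypothesis half of #2 (filed so the S-side is staffed): ∃ δ ∈ (0,1) such that for
every polynomial q there is t with χ_δ(|T⟩^{⊗t}) > q(t). OPEN; the best lower bounds in print are
Ω-polynomial of degree ≤ 2 (PelegShpilkaVolk2022 via higher-order Fourier analysis / quadratic phase
structure of stabilizer states, Labib2022, MehrabanTahmasbi2024 probabilistic method). Proving it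
kills crux #2 of Dequantize (does NOT prove QuantumAdvantage). Imported field: additive
combinatorics (Gowers U³ inverse theory over 𝔽₂ⁿ). NEEDS DEFINITION: approxStabilizerRank.
[needs_definition: approxStabilizerRank] -/
@[route_item "route-QuantumAdvantage-Dequantize"]
def DeqNegStabrankSuperpoly : Prop :=
  ∃ δ : ℝ, 0 < δ ∧ δ < 1 ∧ ∀ c : ℕ, ∃ t : ℕ, t ^ c + c < Literature.Computability.QuantumComplexity.approxStabilizerRank δ (Literature.Computability.QuantumComplexity.tensorPow Literature.Computability.QuantumComplexity.magicT t)

-- earlier DeqStabrankPolyImpliesCollapse (stmt-QuantumAdvantage-0244, replaced 2026-08-15T16:13:50Z -> stmt-QuantumAdvantage-10384): retired by None — (∃ D : (t : ℕ) → ℕ → List (Literature.Computability.Cryptography.QCircuit Literature.Computability.Cryptography.cliffordT t × ℚ × ℚ), Literature.Computability.Complexity.PolyTimeComputable (fun p : ℕ × ℕ => Literature.Computability.Complexity.boolPair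
/-- item stmt-QuantumAdvantage-10384 · support · rank 2 · open · by planner
sources: BravyiGosset2016 = arXiv:1601.07601 §2 p.5 (T-gadgets), §3 p.6 (phase-sensitive stabilizer overlaps in O(n³)), §4 p.7 (P_out = 2^t⟨…⟩), BravyiEtAl2019 = arXiv:1808.00128 §2.1 Def 2 (χ_δ), §2.3.1 p.9 (random-sample gadget method, error O(δ)), PelegShpilkaVolk2022 = arXiv:2106.03214 p.4 (poly χ ⇒ BPP = BQP up to uniformity of the decomposition), MehrabanTahmasbi2024 = arXiv:2305.10277 p.6 Thm 1.10 (non-uniform printed form), AaronsonGottesman2004 = arXiv:quant-ph/0406196 §III (tableau simulation, inner products)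
[support] Half (b) of the route's mechanism, the THEOREM IN PRINT given hypothesis (a): if the magic
state |T⟩^{⊗t} has P-uniform polynomial δ-approximate stabilizer decompositions at every precision δ
= 1/(k+1) (exactly crux DeqStabrankPolyUniform, stmt-1036), then
Literature.Computability.Cryptography.BQP ⊆ Literature.Computability.Complexity.BPP (= DeqThesis):
gadgetise each of the t(n) T gates of the n-th circuit with a magic state and classically controlled
S corrections (BravyiGosset2016 §2, eqs. (3)-(5); gadget outcomes uniformly random, expected squared
simulation error ≤ δ² for a δ-approximate magic state, BravyiEtAl2019 §2.3.1 p.9), expand |T⟩^{⊗t}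
by D(t,k) into poly(t,k) Clifford terms, write the wire-0 acceptance probability as a sum of poly
many phase-sensitive stabilizer inner products each computable exactly in O(n³)
(AaronsonGottesman2004 §III; BravyiGosset2016 §3 p.6) or estimate it by Bravyi–Gosset norm
estimation, to additive error 1/10 in randomized poly time; uniformity of D is what makes the
simulator a single probabilistic poly-time TM (PelegShpilkaVolk2022 p.4: poly χ ⇒ BPP = BQP 'up to
uniformity issues having to do with finding the decomposition'). Rev-4 -/
@[route_item "route-QuantumAdvantage-Dequantize", crux]
def DeqStabrankPolyImpliesCollapse : Prop :=
  DeqStabrankPolyUniform → DeqThesis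

/-- item stmt-QuantumAdvantage-0245 · support · rank 3 · open · by planner
sources: Gottesman1998 = arXiv:quant-ph/9807006 p.13 Thm 1 (Knill's theorem), AaronsonGottesman2004 = arXiv:quant-ph/0406196 §3 p.7–8 (tableau; O(n²) measurement with determinism test ⇒ single-qubit marginal ∈ {0,½,1}), Thm 4 (⊕L ⊆ P), NielsenChuang2010 §10.5.4 Thm 10.7
A Clifford circuit ({H,S,CNOT}) on |x⟩|0^m⟩ has wire-0 acceptance probability in {0, 1/2, 1},
computable in polynomial time by the stabilizer-tableau algorithm; with the (2/3, 1/3) gap the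
language is {x : prob = 1}, in P since the family is poly-time uniform. First rung of the T-count
ladder; calibrates the circuit model. [Gottesman1998; AaronsonGottesman2004 §III (O(n²) per gate,
measurement outcomes/determinism); NielsenChuang2010 §10.5.4] -/
@[route_item "route-QuantumAdvantage-Dequantize"]
def DeqGottesmanKnillUniform : Prop :=
  ∀ F : Literature.Computability.Cryptography.QCircuitFamily Literature.Computability.Cryptography.cliffordT, F.IsOracleFree → F.IsUniform → (∀ n, ∀ q ∈ (F.circ n).gates, ∀ e, q ≠ Literature.Computability.Cryptography.QGate.gate Literature.Computability.Cryptography.CliffordTOp.T e) → ∀ L : Language Bool, (∀ x, (x ∈ L → 2 / 3 ≤ F.acceptProbOn 0 x) ∧ (x ∉ L → F.acceptProbOn 0 x ≤ 1 / 3)) → L ∈ Literature.Computability.Complexity.Classes.P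

/-- item stmt-QuantumAdvantage-0470 · support · rank 6 · open · by planner
sources: MehrabanTahmasbi2024 = arXiv:2305.10277 p.6 Thm 1.10 ('If χ_δ(T^{⊗n}) is upper bounded by a polynomial, then there exists a BPP/poly algorithm to sample … within O(δ) total variation distance'), p.7 (Adleman–Bennett–Gill BPP ⊆ P/poly), BravyiGosset2016 = arXiv:1601.07601 §2 p.5, §4 p.7; BravyiEtAl2019 = arXiv:1808.00128 §2.3.1 p.9, grounder reground note 2026-08-14 (MATCH: item = Thm 1.10 ∘ fix δ ∘ Adleman; ∀δ>0 hypothesis absorbs the unnormalised-φ convention δ ↦ 2δ)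
Half (b) of crux #2 (0244) in NON-UNIFORM form, typed over the landed StabilizerRank.lean
(approxStabilizerRank, tensorPow, magicT). If for every fixed δ > 0 the δ-approximate stabilizer
rank χ_δ(|T⟩^{⊗t}) is ≤ t^c + c, then BQP ⊆ P/poly. Proof in print: gadgetise the t(n) T-gates of
the n-th circuit with magic states (BravyiGosset2016 eqs. (3)-(5); gadget outcomes are uniformly
random and corrected by classically controlled S, so for a random outcome string the expected
squared simulation error is δ², BravyiEtAl2019 §2.3); advice = a δ-optimal stabilizer decomposition
of |T⟩^{⊗t(n)} (χ_δ Clifford words + coefficients to poly(n) bits) + the fixed coins (Adleman); the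
wire-0 acceptance probability is then a sum of χ_δ² stabilizer inner products, each exactly
computable in poly time (AaronsonGottesman2004 §III-IV). RANK: this is the in-print,
formalisation-heavy step; the OPEN content is the hypothesis, whose negation (some δ ∈ (0,1)) is
exactly ¬crux #5 (0247, now with signature). The UNIFORM version (⇒ BQP ⊆ BPP = route thesis) stays
as 0244 (informal; needs an encoding of uniform stabilizer decompositions, deliberately not
requested yet). Cross-route: the hypothesis refutes Circui -/
@[route_item "route-QuantumAdvantage-Dequantize"]
def DeqStabrankPolyImpliesBQPSubsetPPoly : Prop :=
  (∀ δ : ℝ, 0 < δ → ∃ c : ℕ, ∀ t : ℕ, Literature.Computability.QuantumComplexity.approxStabilizerRank δ (Literature.Computability.QuantumComplexity.tensorPow Literature.Computability.QuantumComplexity.magicT t) ≤ t ^ c + c) → Literature.Computability.Cryptography.BQP ⊆ Literature.Computability.Complexity.PPoly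

/-- item stmt-QuantumAdvantage-0471 · support · rank 7 · open · by planner
sources: AaronsonGottesman2004 = arXiv:quant-ph/0406196 §7.3 p.18–19, BravyiGosset2016 = arXiv:1601.07601 §3 p.6 (phase-sensitive exact overlap), p.8 (χ_t ≤ 2^{t/2}), Gottesman1998 = arXiv:quant-ph/9807006 p.13 Thm 1, tree def Literature.Computability.Cryptography.QCircuit.tCount + tCount_eq_zero_iff (Literature/Computability/Cryptography/TCount.lean:124)
SUPERSEDES stmt-QuantumAdvantage-0246 (identical mathematics; the inline countP/match T-counter is
replaced by the landed `Literature.Computability.Cryptography.QCircuit.tCount`, TCount.lean,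
definitionally the same countP of QGate.isT). Claim: a poly-time-uniform oracle-free Clifford+T
family whose n-th circuit has T-count ≤ c·log₂ n + c decides (thresholds 2/3, 1/3) only languages in
P. Proof: T = αI + βS with α + β = 1, α + iβ = e^{iπ/4}; expand U as a sum of 2^t Clifford circuits
and the acceptance probability ⟨x0…0|U†Π U|x0…0⟩ (Π = (1 − Z₀)/2) as a sum of 2·4^t = n^{O(c)}
Clifford amplitudes in ℤ[e^{iπ/4}, 1/2], each computed exactly in poly time by Gottesman–Knill /
Aaronson–Gottesman (Gottesman1998; AaronsonGottesman2004 §III-IV, inner products of stabilizer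
states); compare with 1/2. (BravyiGosset2016 gives the randomized 2^{0.47 t} refinement, not needed
at t = O(log n).) #3 (0245, T-count 0) is the special case and is NOT superseded (its hypothesis is
literally `tCount = 0` via TCount.tCount_eq_zero_iff). -/
@[route_item "route-QuantumAdvantage-Dequantize"]
def DeqLogTcountInPV2 : Prop :=
  ∀ F : Literature.Computability.Cryptography.QCircuitFamily Literature.Computability.Cryptography.cliffordT, F.IsOracleFree → F.IsUniform → (∃ c : ℕ, ∀ n, (F.circ n).tCount ≤ c * Nat.log 2 n + c) → ∀ L : Language Bool, (∀ x, (x ∈ L → 2 / 3 ≤ F.acceptProbOn 0 x) ∧ (x ∉ L → F.acceptProbOn 0 x ≤ 1 / 3)) → L ∈ Literature.Computability.Complexity.Classes.P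

-- earlier Assembly (stmt-QuantumAdvantage-0243, replaced 2026-08-15T16:13:50Z -> stmt-QuantumAdvantage-10385): retired by None — Literature.Computability.QuantumComplexity.BPP_subset_BQP → Literature.Computability.Cryptography.BQP ⊆ Literature.Computability.Complexity.BPP → ¬ QuantumAdvantage
/-- item stmt-QuantumAdvantage-10385 · assembly · rank 1 · open · by planner
[assembly] X → ¬Statement by pure logic: the summit `QuantumAdvantage := ∃ L, L ∈ BQP ∧ L ∉ BPP` is
refuted directly by X = DeqThesis (BQP ⊆ BPP). Rev-4 restatement: the rev-3 form carried the named
fact Literature.Computability.QuantumComplexity.BPP_subset_BQP as an extra (and, for the existential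
summit, vacuous) hypothesis — removed (glue.extra-hypothesis). The deciding theorem is `closes :
DeqStabrankPolyUniform → DeqStabrankPolyImpliesCollapse → ¬ QuantumAdvantage`; this item is its
documentary frame and is provable now by one line (`fun h0 ⟨_, hL, hnL⟩ => hnL (h0 hL)`). -/
@[route_item "route-QuantumAdvantage-Dequantize"]
def Assembly : Prop :=
  DeqThesis → ¬ QuantumAdvantage

/-! D-0027 §2.1 — DECIDING THEOREM (planner-authored via `route open/edit --closes-file`; by planner-rbadge-QuantumAdvantage-Dequantize-5a6faeb9-g2-0 2026-08-15T16:13:50Z):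
its hypotheses are this route's items and its conclusion the sub-problem Statement (glue_lint), and it elaborates with this file. -/

@[closes "route-QuantumAdvantage-Dequantize"] theorem closes (hU : DeqStabrankPolyUniform) (hC : DeqStabrankPolyImpliesCollapse) : ¬ _root_.QuantumAdvantage :=
  fun ⟨_, hL, hnL⟩ => hnL (hC hU hL)

end Summit.QuantumAdvantage.QuantumAdvantage.Theses.Dequantize
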